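/-
Copyright (c) 2026 the pub-hodgecm-mathlib formalisation cell (harness21).  Prover seat hodgecm-mathlib-K2Liu-p13 (g3), Track B «K2-LIT»,
#184♮ = hLiu418 = `stmt-HodgeConjecture-24832`; ROAD Φ (RULING «M-156n»), consumer sheet fa2b1e3a29709f09 row G6-fin, clause (v) of the big-cell package —
letter `K2LiuModDeltaHeightComparison` (K2E5-plan (g7) co-deal 2026-09-04T14:22:38Z (C) (F4); LEAD F0P6-plan (g14) BATCH #30); census
`K2/K2Liu-p13/g3/CENSUS-G6fin-Phi8FacePackaging.K2Liu-p13-g3.md` 065e2d080ef468d9 (F4).  THEOREMS ONLY (no `def`, no `instance`, no named-fact hypothesis, no `sorry`).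
-/
import Literature.NumberTheory.K2Lit.SiegelEisensteinSeriesDoubled                       -- ★ `modDelta_pos`; frame `HA`, `IsSiegelDelta`, `deltaBlock`, `modDelta`
import Literature.NumberTheory.Automorphic.IdeleNormDetGL                                -- ★ `ideleNorm_det_le_height`, `ideleNorm_det_inv_le_height`
import Literature.NumberTheory.Automorphic.AdelicHeightGLSiegel                           -- ★ `exists_adelicHeightGL_le_of_isCompact`
import Summits.HodgeConjecture.HodgeConjecture.Theorems.K2LiuAdelicHeightGLVsVecHeight     -- ★ `map_adeleEval_coe_apply`, `…_inv_…`, `toMixed_inv_coe_apply`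
import Mathlib.Analysis.SpecialFunctions.Pow.Complex
import HarnessLib

/-!
# Crux `HLiu418`, ROAD Φ, organ Φ8 (sheet row G6-fin): THE SIEGEL MODULUS AGAINST THE ADELIC HEIGHT —
# `|det_Δ p|_𝔸^{±1/2} ≤ C·‖p‖^A` on `P_Δ(𝔸)`, and the character bound `hω` of ★ `K2LiuBigCellGrowthOfEquivariance.growth_of_equivariance`

Cell `hodgecm-mathlib`, crux item hLiu418 = `stmt-HodgeConjecture-24832` (helper lane, count-neutral).  The inducing character of the degenerate principal
series `I(s, χ)` of the doubled unitary group `H(𝔸) = U(𝕍 ⊕ −𝕍)(𝔸) ≤ GL_{2n}(𝔸_L)` is `p ↦ χ(det_Δ p)·modDelta(p)^{2s+n}` on the Siegel parabolic `P_Δ(𝔸)`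
(★ `siegelDeltaCharacter`, ★ `modDelta p = |det_Δ p|_{𝔸_L}^{1/2}`, ★ `IsSiegelDelta`).  Every growth estimate of an induced function in the Borel–Jacquet height
`‖h‖ = adelicHeightGL (n+n) L h` (socket #41's clause (A5); ★ Φ9; ★ `K2LiuBigCellGrowthOfEquivariance`) needs the comparison of the MODULUS with the HEIGHT:
**`modDelta p ≤ C·‖p‖^A` and `modDelta p⁻¹ ≤ C·‖p‖^A` for all `p ∈ P_Δ(𝔸)`** ([MoeglinWaldspurger1995, I.2.2 (vi)–(vii)]; [BorelJacquet1979, §1.2]).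
PROOF.  `det_Δ p` is the determinant of the `Δ`-block `p|_Δ = p₁₁ + p₁₂` (★ `deltaBlock`, multiplicative on `P_Δ(𝔸)` ★ `deltaBlock_mul`), an element `g_p` of
`GL_n(𝔸_L)` with inverse `p⁻¹|_Δ`; every entry of `g_p` (resp. `g_p⁻¹`) is a sum of TWO entries of `p` (resp. `p⁻¹`), so `H_v(g_p) ≤ H_v(p)` at every finite place
(ultrametric) and `H_∞(g_p) ≤ 2 H_∞(p)`, whence `‖g_p‖ ≤ 2‖p‖` (§1, generic over `GL`); and ★ `ideleNorm_det_le_height` ∕ `ideleNorm_det_inv_le_height`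
(`|det g|_𝔸^{±1} ≤ (n!)^d (1 ⊔ ‖g‖)^{nd}`, `d = [L:ℚ]`) give `modDelta(p)^{±2} ≤ (n!)^d (1 ⊔ 2‖p‖)^{nd}` (§3); the height floor `‖p‖ ≥ c₀ > 0` turns `1 ⊔ 2‖p‖` into `C‖p‖`.
EXPORTS for ★ `growth_of_equivariance` (its binders, verbatim shapes): §4 `exists_modDelta_le_height` (both directions), `exists_modDelta_rpow_le_height`
(`modDelta p ^ t ≤ C·‖p‖^A` uniformly for `|t| ≤ T`), **`exists_character_bound`** = the binder `hω` for `ω s p := u s p · (modDelta p : ℂ)^(κ − 2s)` with `‖u s p‖ ≤ 1`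
(the unitary part `χ′(det_Δ p)` BY VALUE), and `exists_height_le_mul_height_mul` = the binder `hPK` (`‖p‖ ≤ C_K‖p k‖` for `k` in a compact `K`, ★
`adelicHeightGL_mul_le_const`, ★ `adelicHeightGL_inv`, ★ `exists_adelicHeightGL_le_of_isCompact`).
HONEST LABEL.  Helper lemmas, count-neutral; `HC_CM` is proved only modulo the 7 printed citations (2 remaining named inputs:
hLiu418 = `stmt-HodgeConjecture-24832`, h413 = `stmt-HodgeConjecture-24833`) until rung 0 closes.
-/

set_option autoImplicit false
set_option linter.dupNamespace false -- the mandated namespace repeats `HodgeConjecture.HodgeConjecture`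

noncomputable section

namespace Summit.HodgeConjecture.HodgeConjecture.Cruxes.HLiu418.K2LiuModDeltaHeightComparison

open scoped NNReal Matrix Classical
open NumberField NumberField.mixedEmbedding IsDedekindDomain Metric
open Literature.NumberTheory.Automorphic Literature.NumberTheory.GaloisRepresentations
open Literature.NumberTheory.GelbartRogawski1991 Literature.NumberTheory.GelbartRogawski1991.GRConstruction
open Literature.NumberTheory.K2Lit.SiegelDoubled
open Summit.HodgeConjecture.HodgeConjecture.Cruxes.HLiu418.K2LiuAdelicHeightGLVsVecHeight
  (map_adeleEval_coe_apply map_adeleEval_inv_coe_apply toMixed_inv_coe_apply)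

/-! ## §1 Generic: a `GL_m` element whose entries are sums of two entries of a `GL_N` element has height `≤ 2 ·` its height -/

section Generic

variable {K : Type} [Field K] [NumberField K] {m N : ℕ}

/-- **Local heights: `H_v(g') ≤ H_v(g)`** when every entry of `g'` (resp. `g'⁻¹`) is a sum of two entries of `g` (resp. `g⁻¹`) — the `v`-adic norm is
ultrametric. [cite: BorelJacquet1979, §1.2] -/
theorem localHeight_le_of_entries_add (g' : GL (Fin m) (AdeleRing (𝓞 K) K)) (g : GL (Fin N) (AdeleRing (𝓞 K) K))
    (h : ∀ i j, ∃ a b a' b', (g' : Matrix (Fin m) (Fin m) (AdeleRing (𝓞 K) K)) i j =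
      (g : Matrix (Fin N) (Fin N) (AdeleRing (𝓞 K) K)) a b + (g : Matrix (Fin N) (Fin N) (AdeleRing (𝓞 K) K)) a' b')
    (h' : ∀ i j, ∃ a b a' b', ((g'⁻¹ : GL (Fin m) (AdeleRing (𝓞 K) K)) : Matrix (Fin m) (Fin m) (AdeleRing (𝓞 K) K)) i j =
      ((g⁻¹ : GL (Fin N) (AdeleRing (𝓞 K) K)) : Matrix (Fin N) (Fin N) (AdeleRing (𝓞 K) K)) a b +
        ((g⁻¹ : GL (Fin N) (AdeleRing (𝓞 K) K)) : Matrix (Fin N) (Fin N) (AdeleRing (𝓞 K) K)) a' b')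
    (v : HeightOneSpectrum (𝓞 K)) : GLn.localHeight m K v g' ≤ GLn.localHeight N K v g := by
  unfold GLn.localHeight
  refine Finset.sup_le fun ij _ => sup_le ?_ ?_
  · obtain ⟨a, b, a', b', hab⟩ := h ij.1 ij.2
    rw [map_adeleEval_coe_apply, hab]
    change ‖AdelicGroupData.adeleEval K v (_ + _)‖₊ ≤ _
    rw [map_add]
    refine (IsUltrametricDist.nnnorm_add_le_max _ _).trans (max_le ?_ ?_)
    · have := nnnorm_apply_le_sup (Matrix.GeneralLinearGroup.map (AdelicGroupData.adeleEval K v) g) a b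
      rwa [map_adeleEval_coe_apply] at this
    · have := nnnorm_apply_le_sup (Matrix.GeneralLinearGroup.map (AdelicGroupData.adeleEval K v) g) a' b'
      rwa [map_adeleEval_coe_apply] at this
  · obtain ⟨a, b, a', b', hab⟩ := h' ij.1 ij.2
    rw [map_adeleEval_inv_coe_apply, hab]
    change ‖AdelicGroupData.adeleEval K v (_ + _)‖₊ ≤ _
    rw [map_add]
    refine (IsUltrametricDist.nnnorm_add_le_max _ _).trans (max_le ?_ ?_)
    · have := nnnorm_inv_apply_le_sup (Matrix.GeneralLinearGroup.map (AdelicGroupData.adeleEval K v) g) a b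
      rwa [map_adeleEval_inv_coe_apply] at this
    · have := nnnorm_inv_apply_le_sup (Matrix.GeneralLinearGroup.map (AdelicGroupData.adeleEval K v) g) a' b'
      rwa [map_adeleEval_inv_coe_apply] at this

/-- **Archimedean height: `H_∞(g') ≤ 2 H_∞(g)`** under the same hypothesis (triangle inequality in the mixed space). [cite: BorelJacquet1979, §1.2] -/
theorem archHeight_le_two_mul_of_entries_add (g' : GL (Fin m) (AdeleRing (𝓞 K) K)) (g : GL (Fin N) (AdeleRing (𝓞 K) K))
    (h : ∀ i j, ∃ a b a' b', (g' : Matrix (Fin m) (Fin m) (AdeleRing (𝓞 K) K)) i j =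
      (g : Matrix (Fin N) (Fin N) (AdeleRing (𝓞 K) K)) a b + (g : Matrix (Fin N) (Fin N) (AdeleRing (𝓞 K) K)) a' b')
    (h' : ∀ i j, ∃ a b a' b', ((g'⁻¹ : GL (Fin m) (AdeleRing (𝓞 K) K)) : Matrix (Fin m) (Fin m) (AdeleRing (𝓞 K) K)) i j =
      ((g⁻¹ : GL (Fin N) (AdeleRing (𝓞 K) K)) : Matrix (Fin N) (Fin N) (AdeleRing (𝓞 K) K)) a b +
        ((g⁻¹ : GL (Fin N) (AdeleRing (𝓞 K) K)) : Matrix (Fin N) (Fin N) (AdeleRing (𝓞 K) K)) a' b') :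
    GLn.archHeight m K g' ≤ 2 * GLn.archHeight N K g := by
  -- the mixed-space image of the infinite component is additive, and the sup norm is subadditive
  have key : ∀ x y : AdeleRing (𝓞 K) K,
      ‖InfiniteAdeleRing.ringEquiv_mixedSpace K ((x + y).1)‖₊ ≤
        ‖InfiniteAdeleRing.ringEquiv_mixedSpace K x.1‖₊ + ‖InfiniteAdeleRing.ringEquiv_mixedSpace K y.1‖₊ := by
    intro x y
    have hxy : (x + y).1 = x.1 + y.1 := rfl
    rw [hxy, map_add]
    exact nnnorm_add_le _ _
  unfold GLn.archHeight
  refine Finset.sup_le fun ij _ => sup_le ?_ ?_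
  · obtain ⟨a, b, a', b', hab⟩ := h ij.1 ij.2
    -- `((g'_∞)_{ij}) = ι(((g')_{ij})_∞)` definitionally (★ `GLn.coe_toMixed_apply`)
    change ‖InfiniteAdeleRing.ringEquiv_mixedSpace K (((g' : Matrix (Fin m) (Fin m) (AdeleRing (𝓞 K) K)) ij.1 ij.2).1)‖₊ ≤ _
    rw [hab]
    refine (key _ _).trans ?_
    rw [two_mul]
    exact add_le_add (nnnorm_apply_le_sup (GLn.toMixed N K g) a b) (nnnorm_apply_le_sup (GLn.toMixed N K g) a' b')
  · obtain ⟨a, b, a', b', hab⟩ := h' ij.1 ij.2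
    rw [toMixed_inv_coe_apply, hab]
    refine (key _ _).trans ?_
    rw [two_mul]
    refine add_le_add ?_ ?_
    · have := nnnorm_inv_apply_le_sup (GLn.toMixed N K g) a b
      rwa [toMixed_inv_coe_apply] at this
    · have := nnnorm_inv_apply_le_sup (GLn.toMixed N K g) a' b'
      rwa [toMixed_inv_coe_apply] at this

/-- **`‖g'‖ ≤ 2‖g‖`** when every entry of `g'` (resp. `g'⁻¹`) is a sum of two entries of `g` (resp. `g⁻¹`): the Borel–Jacquet height of ★ `adelicHeightGL`
is `H_∞ · ∏ᶠ_v H_v` with `H_v ≥ 1` almost always `1`. [cite: BorelJacquet1979, §1.2] -/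
theorem adelicHeightGL_le_two_mul_of_entries_add [NeZero m] [NeZero N] (g' : GL (Fin m) (AdeleRing (𝓞 K) K)) (g : GL (Fin N) (AdeleRing (𝓞 K) K))
    (h : ∀ i j, ∃ a b a' b', (g' : Matrix (Fin m) (Fin m) (AdeleRing (𝓞 K) K)) i j =
      (g : Matrix (Fin N) (Fin N) (AdeleRing (𝓞 K) K)) a b + (g : Matrix (Fin N) (Fin N) (AdeleRing (𝓞 K) K)) a' b')
    (h' : ∀ i j, ∃ a b a' b', ((g'⁻¹ : GL (Fin m) (AdeleRing (𝓞 K) K)) : Matrix (Fin m) (Fin m) (AdeleRing (𝓞 K) K)) i j =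
      ((g⁻¹ : GL (Fin N) (AdeleRing (𝓞 K) K)) : Matrix (Fin N) (Fin N) (AdeleRing (𝓞 K) K)) a b +
        ((g⁻¹ : GL (Fin N) (AdeleRing (𝓞 K) K)) : Matrix (Fin N) (Fin N) (AdeleRing (𝓞 K) K)) a' b') :
    adelicHeightGL m K g' ≤ 2 * adelicHeightGL N K g := by
  have hfin : ∀ {k : ℕ} [NeZero k] (x : GL (Fin k) (AdeleRing (𝓞 K) K)),
      Function.HasFiniteMulSupport fun v => (GLn.localHeight k K v x : ℝ) := by
    intro k _ x
    refine (GLn.mulSupport_localHeight_finite_holds x).subset fun v hv => ?_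
    simpa [Function.mem_mulSupport] using hv
  have hloc : ∏ᶠ v, (GLn.localHeight m K v g' : ℝ) ≤ ∏ᶠ v, (GLn.localHeight N K v g : ℝ) :=
    finprod_le_finprod (hfin g') (fun _ => NNReal.coe_nonneg _) (hfin g) fun v => by
      exact_mod_cast localHeight_le_of_entries_add g' g h h' v
  have harch : (GLn.archHeight m K g' : ℝ) ≤ 2 * GLn.archHeight N K g := by
    exact_mod_cast archHeight_le_two_mul_of_entries_add g' g h h'
  unfold adelicHeightGL
  calc (GLn.archHeight m K g' : ℝ) * ∏ᶠ v, (GLn.localHeight m K v g' : ℝ)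
      ≤ (2 * GLn.archHeight N K g) * ∏ᶠ v, (GLn.localHeight N K v g : ℝ) :=
        mul_le_mul harch hloc (finprod_nonneg fun _ => NNReal.coe_nonneg _) (by positivity)
    _ = 2 * ((GLn.archHeight N K g : ℝ) * ∏ᶠ v, (GLn.localHeight N K v g : ℝ)) := by ring

/-- A HEIGHT FLOOR: `‖g‖ ≥ c₀ > 0` on `GL_N(𝔸_K)` (`‖1‖ ≤ N‖g‖‖g⁻¹‖ = N‖g‖²`; ★ `adelicHeightGL_mul_le_const`, ★ `adelicHeightGL_inv`), in the form
`1 ⊔ 2‖g‖ ≤ C₁·‖g‖`. [cite: BorelJacquet1979, §1.2] -/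
theorem exists_one_sup_two_mul_le [NeZero N] :
    ∃ C₁ : ℝ, 0 < C₁ ∧ ∀ g : GL (Fin N) (AdeleRing (𝓞 K) K), 1 ⊔ 2 * adelicHeightGL N K g ≤ C₁ * adelicHeightGL N K g := by
  have h1 : 0 < adelicHeightGL N K (1 : GL (Fin N) (AdeleRing (𝓞 K) K)) := adelicHeightGL_pos_holds 1
  -- floor: `‖1‖ ≤ N ‖g‖ ‖g⁻¹‖ = N ‖g‖²`, so `‖g‖ ≥ c₀ := √(‖1‖/N)`
  set c₀ : ℝ := Real.sqrt (adelicHeightGL N K (1 : GL (Fin N) (AdeleRing (𝓞 K) K)) / N) with hc₀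
  have hN : (0 : ℝ) < N := by exact_mod_cast Nat.pos_of_ne_zero (NeZero.ne N)
  have hc₀pos : 0 < c₀ := Real.sqrt_pos.2 (div_pos h1 hN)
  have hfloor : ∀ g : GL (Fin N) (AdeleRing (𝓞 K) K), c₀ ≤ adelicHeightGL N K g := by
    intro g
    have hg0 : 0 ≤ adelicHeightGL N K g := adelicHeightGL_nonneg _
    have h2 := adelicHeightGL_mul_le_const (n := N) (K := K) g g⁻¹
    rw [mul_inv_cancel, adelicHeightGL_inv] at h2
    have h3 : adelicHeightGL N K (1 : GL (Fin N) (AdeleRing (𝓞 K) K)) / N ≤ adelicHeightGL N K g ^ 2 := by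
      rw [div_le_iff₀ hN]; nlinarith
    calc c₀ ≤ Real.sqrt (adelicHeightGL N K g ^ 2) := Real.sqrt_le_sqrt h3
      _ = adelicHeightGL N K g := Real.sqrt_sq hg0
  refine ⟨c₀⁻¹ ⊔ 2, lt_sup_of_lt_left (inv_pos.2 hc₀pos), fun g => sup_le ?_ ?_⟩
  · calc (1 : ℝ) = c₀⁻¹ * c₀ := (inv_mul_cancel₀ hc₀pos.ne').symm
      _ ≤ c₀⁻¹ * adelicHeightGL N K g := mul_le_mul_of_nonneg_left (hfloor g) (inv_pos.2 hc₀pos).le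
      _ ≤ (c₀⁻¹ ⊔ 2) * adelicHeightGL N K g := mul_le_mul_of_nonneg_right le_sup_left (adelicHeightGL_nonneg _)
  · exact mul_le_mul_of_nonneg_right le_sup_right (adelicHeightGL_nonneg _)

/-- **`hPK` of ★ `growth_of_equivariance`: `‖g‖ ≤ C_K·‖g k‖` for `k` in a compact set** (`g = (g k) k⁻¹`, ★ `adelicHeightGL_mul_le_const`, ★ `adelicHeightGL_inv`,
★ `exists_adelicHeightGL_le_of_isCompact`). [cite: BorelJacquet1979, §1.2] [cite: MoeglinWaldspurger1995, I.2.2] -/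
theorem exists_height_le_mul_height_mul {C : Set (GL (Fin N) (AdeleRing (𝓞 K) K))} (hC : IsCompact C) :
    ∃ CK : ℝ, 0 ≤ CK ∧ ∀ g : GL (Fin N) (AdeleRing (𝓞 K) K), ∀ k ∈ C, adelicHeightGL N K g ≤ CK * adelicHeightGL N K (g * k) := by
  obtain ⟨B, hB0, hB⟩ := exists_adelicHeightGL_le_of_isCompact hC
  refine ⟨N * B, by positivity, fun g k hk => ?_⟩
  have h1 := adelicHeightGL_mul_le_const (n := N) (K := K) (g * k) k⁻¹
  rw [mul_inv_cancel_right, adelicHeightGL_inv] at h1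
  calc adelicHeightGL N K g ≤ N * adelicHeightGL N K (g * k) * adelicHeightGL N K k := h1
    _ ≤ N * adelicHeightGL N K (g * k) * B :=
        mul_le_mul_of_nonneg_left (hB k hk) (mul_nonneg (Nat.cast_nonneg _) (adelicHeightGL_nonneg _))
    _ = N * B * adelicHeightGL N K (g * k) := by ring

end Generic

/-! ## §2 The `Δ`-block of `p ∈ P_Δ(𝔸)` as an element of `GL_n(𝔸_L)` -/

section Frame

variable (L : Type) [Field L] [NumberField L] [IsCMField L]
variable {N M n : ℕ} (e : Fin N × Fin M ≃ Fin n)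
  (dV : Fin N → L) (hdV : ∀ i, IsCMField.complexConj L (dV i) = dV i)
  (dW : Fin M → L) (hdW : ∀ i, IsCMField.complexConj L (dW i) = dW i)

/-- entries of the `Δ`-block: `(p|_Δ)_{ij} = p_{(inl i)(inl j)} + p_{(inl i)(inr j)}` in the block enumeration `e₂ : Fin n ⊕ Fin n ≃ Fin (n+n)`.
[cite: GelbartRogawski1991, §3.1 Prop. 3.1.1 p. 455 L1–2] -/
theorem deltaBlock_apply (p : HA L e dV hdV dW hdW) (i j : Fin n) :
    deltaBlock L e dV hdV dW hdW p i j =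
      ((p : GL (Fin (n + n)) (AdeleRing (𝓞 L) L)) : Matrix (Fin (n + n)) (Fin (n + n)) (AdeleRing (𝓞 L) L)) (e₂ (Sum.inl i)) (e₂ (Sum.inl j)) +
      ((p : GL (Fin (n + n)) (AdeleRing (𝓞 L) L)) : Matrix (Fin (n + n)) (Fin (n + n)) (AdeleRing (𝓞 L) L)) (e₂ (Sum.inl i)) (e₂ (Sum.inr j)) := by
  simp [deltaBlock, blk, Matrix.toBlocks₁₁, Matrix.toBlocks₁₂]

/-- `1|_Δ = 1`. [cite: GelbartRogawski1991, §3.1 Prop. 3.1.1 p. 455 L1–2] -/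
theorem deltaBlock_one : deltaBlock L e dV hdV dW hdW 1 = 1 := by
  unfold deltaBlock
  rw [blk_one, ← Matrix.fromBlocks_one, Matrix.toBlocks_fromBlocks₁₁, Matrix.toBlocks_fromBlocks₁₂, add_zero]

/-- `p|_Δ · p⁻¹|_Δ = 1` on `P_Δ(𝔸)`. [cite: GelbartRogawski1991, §3.1 Prop. 3.1.1 p. 455 L1–2] -/
theorem deltaBlock_mul_deltaBlock_inv {p : HA L e dV hdV dW hdW} (hp : IsSiegelDelta L e dV hdV dW hdW p) :
    deltaBlock L e dV hdV dW hdW p * deltaBlock L e dV hdV dW hdW p⁻¹ = 1 := by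
  rw [← deltaBlock_mul L e dV hdV dW hdW hp (isSiegelDelta_inv L e dV hdV dW hdW hp), mul_inv_cancel, deltaBlock_one]

/-- `p⁻¹|_Δ · p|_Δ = 1` on `P_Δ(𝔸)`. [cite: GelbartRogawski1991, §3.1 Prop. 3.1.1 p. 455 L1–2] -/
theorem deltaBlock_inv_mul_deltaBlock {p : HA L e dV hdV dW hdW} (hp : IsSiegelDelta L e dV hdV dW hdW p) :
    deltaBlock L e dV hdV dW hdW p⁻¹ * deltaBlock L e dV hdV dW hdW p = 1 := by
  rw [← deltaBlock_mul L e dV hdV dW hdW (isSiegelDelta_inv L e dV hdV dW hdW hp) hp, inv_mul_cancel, deltaBlock_one]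

/-- **the `Δ`-block is a unit**: there is `g ∈ GL_n(𝔸_L)` with matrix `p|_Δ` (and inverse `p⁻¹|_Δ`). [cite: GelbartRogawski1991, §3.1 Prop. 3.1.1 p. 455 L1–2] -/
theorem exists_gl_coe_eq_deltaBlock {p : HA L e dV hdV dW hdW} (hp : IsSiegelDelta L e dV hdV dW hdW p) :
    ∃ g : GL (Fin n) (AdeleRing (𝓞 L) L), (g : Matrix (Fin n) (Fin n) (AdeleRing (𝓞 L) L)) = deltaBlock L e dV hdV dW hdW p :=
  ⟨⟨deltaBlock L e dV hdV dW hdW p, deltaBlock L e dV hdV dW hdW p⁻¹, deltaBlock_mul_deltaBlock_inv L e dV hdV dW hdW hp,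
    deltaBlock_inv_mul_deltaBlock L e dV hdV dW hdW hp⟩, rfl⟩

/-- the inverse of such a `g` has matrix `p⁻¹|_Δ`. [cite: GelbartRogawski1991, §3.1 Prop. 3.1.1 p. 455 L1–2] -/
theorem coe_inv_eq_deltaBlock_inv {p : HA L e dV hdV dW hdW} (hp : IsSiegelDelta L e dV hdV dW hdW p)
    {g : GL (Fin n) (AdeleRing (𝓞 L) L)} (hg : (g : Matrix (Fin n) (Fin n) (AdeleRing (𝓞 L) L)) = deltaBlock L e dV hdV dW hdW p) :
    ((g⁻¹ : GL (Fin n) (AdeleRing (𝓞 L) L)) : Matrix (Fin n) (Fin n) (AdeleRing (𝓞 L) L)) = deltaBlock L e dV hdV dW hdW p⁻¹ := by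
  have h1 : ((g⁻¹ : GL (Fin n) (AdeleRing (𝓞 L) L)) : Matrix (Fin n) (Fin n) (AdeleRing (𝓞 L) L)) * deltaBlock L e dV hdV dW hdW p = 1 := by
    rw [← hg, ← Units.val_mul, inv_mul_cancel, Units.val_one]
  calc ((g⁻¹ : GL (Fin n) (AdeleRing (𝓞 L) L)) : Matrix (Fin n) (Fin n) (AdeleRing (𝓞 L) L))
      = ((g⁻¹ : GL (Fin n) (AdeleRing (𝓞 L) L)) : Matrix (Fin n) (Fin n) (AdeleRing (𝓞 L) L)) *
          (deltaBlock L e dV hdV dW hdW p * deltaBlock L e dV hdV dW hdW p⁻¹) := by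
        rw [deltaBlock_mul_deltaBlock_inv L e dV hdV dW hdW hp, mul_one]
    _ = deltaBlock L e dV hdV dW hdW p⁻¹ := by rw [← mul_assoc, h1, one_mul]

/-- **`‖p|_Δ‖ ≤ 2‖p‖`**: the height of the `Δ`-block is at most twice the height of `p` in `GL_{2n}(𝔸_L)`. [cite: BorelJacquet1979, §1.2] [cite: MoeglinWaldspurger1995, I.2.2] -/
theorem adelicHeightGL_deltaBlock_le [NeZero n] {p : HA L e dV hdV dW hdW} (hp : IsSiegelDelta L e dV hdV dW hdW p)
    {g : GL (Fin n) (AdeleRing (𝓞 L) L)} (hg : (g : Matrix (Fin n) (Fin n) (AdeleRing (𝓞 L) L)) = deltaBlock L e dV hdV dW hdW p) :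
    adelicHeightGL n L g ≤ 2 * adelicHeightGL (n + n) L (p : GL (Fin (n + n)) (AdeleRing (𝓞 L) L)) := by
  haveI : NeZero (n + n) := ⟨fun h => NeZero.ne n (by omega)⟩
  refine adelicHeightGL_le_two_mul_of_entries_add g (p : GL (Fin (n + n)) (AdeleRing (𝓞 L) L)) (fun i j => ?_) (fun i j => ?_)
  · exact ⟨e₂ (Sum.inl i), e₂ (Sum.inl j), e₂ (Sum.inl i), e₂ (Sum.inr j), by rw [hg, deltaBlock_apply]⟩
  · refine ⟨e₂ (Sum.inl i), e₂ (Sum.inl j), e₂ (Sum.inl i), e₂ (Sum.inr j), ?_⟩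
    rw [coe_inv_eq_deltaBlock_inv L e dV hdV dW hdW hp hg, deltaBlock_apply, Subgroup.coe_inv]

/-! ## §3 `modDelta(p)^{±2} = |det p|_Δ|^{±1} ≤ (n!)^d (1 ⊔ 2‖p‖)^{nd}` -/

/-- `modDelta(p)² = |det g|_𝔸` for any `g ∈ GL_n(𝔸_L)` with matrix `p|_Δ` (`p ∈ P_Δ(𝔸)`). [cite: GelbartRogawski1991, §3.1 Prop. 3.1.1 p. 455 L1–2] -/
theorem modDelta_sq_eq_ideleNorm_det {p : HA L e dV hdV dW hdW} (hp : IsSiegelDelta L e dV hdV dW hdW p)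
    {g : GL (Fin n) (AdeleRing (𝓞 L) L)} (hg : (g : Matrix (Fin n) (Fin n) (AdeleRing (𝓞 L) L)) = deltaBlock L e dV hdV dW hdW p) :
    modDelta L e dV hdV dW hdW p ^ 2 = ideleNorm (Matrix.GeneralLinearGroup.det g) := by
  have hu : IsUnit (detDelta L e dV hdV dW hdW p) := isUnit_detDelta_of_isSiegelDelta L e dV hdV dW hdW p hp
  have hunit : hu.unit = Matrix.GeneralLinearGroup.det g := by
    ext
    rw [IsUnit.unit_spec, Matrix.GeneralLinearGroup.val_det_apply, hg]
    rfl
  have h0 : 0 ≤ ideleNorm hu.unit := by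
    unfold ideleNorm
    exact mul_nonneg (Finset.prod_nonneg fun _ _ => by positivity) (finprod_nonneg fun _ => norm_nonneg _)
  unfold modDelta
  rw [dif_pos hu, Real.sq_sqrt h0, hunit]

/-- **`modDelta(p)² ≤ (n!)^d · (1 ⊔ 2‖p‖)^{nd}`** (`d = [L:ℚ]`; ★ `ideleNorm_det_le_height` on the `Δ`-block + §2). [cite: MoeglinWaldspurger1995, I.2.2 (vi)] [cite: BorelJacquet1979, §1.2] -/
theorem modDelta_sq_le [NeZero n] {p : HA L e dV hdV dW hdW} (hp : IsSiegelDelta L e dV hdV dW hdW p) :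
    modDelta L e dV hdV dW hdW p ^ 2 ≤ (n.factorial : ℝ) ^ Module.finrank ℚ L *
      (1 ⊔ 2 * adelicHeightGL (n + n) L (p : GL (Fin (n + n)) (AdeleRing (𝓞 L) L))) ^ (n * Module.finrank ℚ L) := by
  obtain ⟨g, hg⟩ := exists_gl_coe_eq_deltaBlock L e dV hdV dW hdW hp
  rw [modDelta_sq_eq_ideleNorm_det L e dV hdV dW hdW hp hg]
  refine (ideleNorm_det_le_height g).trans (mul_le_mul_of_nonneg_left ?_ (by positivity))
  exact pow_le_pow_left₀ (le_sup_of_le_left zero_le_one) (sup_le_sup_left (adelicHeightGL_deltaBlock_le L e dV hdV dW hdW hp hg) _) _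

/-- **`modDelta(p)⁻² ≤ (n!)^d · (1 ⊔ 2‖p‖)^{nd}`** (★ `ideleNorm_det_inv_le_height` on the `Δ`-block + §2). [cite: MoeglinWaldspurger1995, I.2.2 (vi)] [cite: BorelJacquet1979, §1.2] -/
theorem modDelta_sq_inv_le [NeZero n] {p : HA L e dV hdV dW hdW} (hp : IsSiegelDelta L e dV hdV dW hdW p) :
    (modDelta L e dV hdV dW hdW p ^ 2)⁻¹ ≤ (n.factorial : ℝ) ^ Module.finrank ℚ L *
      (1 ⊔ 2 * adelicHeightGL (n + n) L (p : GL (Fin (n + n)) (AdeleRing (𝓞 L) L))) ^ (n * Module.finrank ℚ L) := by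
  obtain ⟨g, hg⟩ := exists_gl_coe_eq_deltaBlock L e dV hdV dW hdW hp
  rw [modDelta_sq_eq_ideleNorm_det L e dV hdV dW hdW hp hg]
  refine (ideleNorm_det_inv_le_height g).trans (mul_le_mul_of_nonneg_left ?_ (by positivity))
  exact pow_le_pow_left₀ (le_sup_of_le_left zero_le_one) (sup_le_sup_left (adelicHeightGL_deltaBlock_le L e dV hdV dW hdW hp hg) _) _

/-! ## §4 Exports: both directions, real powers, the character bound `hω` -/

/-- **THE MODULUS AGAINST THE HEIGHT, BOTH DIRECTIONS**: `modDelta p ≤ C·‖p‖^A` and `(modDelta p)⁻¹ ≤ C·‖p‖^A` for every `p ∈ P_Δ(𝔸)` (`n ≥ 1`), with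
`A = n[L:ℚ]/2`. [cite: MoeglinWaldspurger1995, I.2.2 (vi)–(vii)] [cite: BorelJacquet1979, §1.2] -/
theorem exists_modDelta_le_height [NeZero n] :
    ∃ C A : ℝ, 0 < C ∧ 0 ≤ A ∧ ∀ p : HA L e dV hdV dW hdW, IsSiegelDelta L e dV hdV dW hdW p →
      modDelta L e dV hdV dW hdW p ≤ C * adelicHeightGL (n + n) L (p : GL (Fin (n + n)) (AdeleRing (𝓞 L) L)) ^ A ∧
      (modDelta L e dV hdV dW hdW p)⁻¹ ≤ C * adelicHeightGL (n + n) L (p : GL (Fin (n + n)) (AdeleRing (𝓞 L) L)) ^ A := by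
  haveI : NeZero (n + n) := ⟨fun h => NeZero.ne n (by omega)⟩
  obtain ⟨C₁, hC₁, hfl⟩ := exists_one_sup_two_mul_le (K := L) (N := n + n)
  set d : ℕ := Module.finrank ℚ L with hd
  set F : ℝ := (n.factorial : ℝ) ^ d with hF
  have hF0 : 0 < F := by positivity
  -- `modDelta^{±2} ≤ F (C₁ ‖p‖)^{nd}`, so `modDelta^{±1} ≤ √F · (C₁‖p‖)^{nd/2} = √F · C₁^{nd/2} · ‖p‖^{nd/2}`
  refine ⟨Real.sqrt F * C₁ ^ (((n * d : ℕ) : ℝ) / 2), ((n * d : ℕ) : ℝ) / 2, by positivity, by positivity, fun p hp => ?_⟩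
  set x : ℝ := adelicHeightGL (n + n) L (p : GL (Fin (n + n)) (AdeleRing (𝓞 L) L)) with hx
  have hx0 : 0 ≤ x := adelicHeightGL_nonneg _
  have hmpos : 0 < modDelta L e dV hdV dW hdW p := modDelta_pos L e dV hdV dW hdW p
  have hC₁x : 0 ≤ C₁ * x := mul_nonneg hC₁.le hx0
  have hsup : (1 ⊔ 2 * x) ^ (n * d) ≤ (C₁ * x) ^ (n * d) := pow_le_pow_left₀ (le_sup_of_le_left zero_le_one) (hfl _) _
  have hkey : ∀ y : ℝ, 0 < y → y ^ 2 ≤ F * (1 ⊔ 2 * x) ^ (n * d) →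
      y ≤ Real.sqrt F * C₁ ^ (((n * d : ℕ) : ℝ) / 2) * x ^ (((n * d : ℕ) : ℝ) / 2) := by
    intro y hy hle
    have h1 : y ^ 2 ≤ F * (C₁ * x) ^ (n * d) := hle.trans (mul_le_mul_of_nonneg_left hsup hF0.le)
    have h2 : y ≤ Real.sqrt (F * (C₁ * x) ^ (n * d)) := (Real.le_sqrt hy.le (mul_nonneg hF0.le (pow_nonneg hC₁x _))).2 h1
    have h3 : Real.sqrt ((C₁ * x) ^ (n * d)) = (C₁ * x) ^ (((n * d : ℕ) : ℝ) / 2) := by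
      rw [Real.sqrt_eq_rpow, ← Real.rpow_natCast, ← Real.rpow_mul hC₁x]
      congr 1
      ring
    calc y ≤ Real.sqrt (F * (C₁ * x) ^ (n * d)) := h2
      _ = Real.sqrt F * (C₁ * x) ^ (((n * d : ℕ) : ℝ) / 2) := by rw [Real.sqrt_mul hF0.le, h3]
      _ = Real.sqrt F * C₁ ^ (((n * d : ℕ) : ℝ) / 2) * x ^ (((n * d : ℕ) : ℝ) / 2) := by
          rw [Real.mul_rpow hC₁.le hx0, mul_assoc]
  refine ⟨hkey _ hmpos (modDelta_sq_le L e dV hdV dW hdW hp), hkey _ (inv_pos.2 hmpos) ?_⟩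
  rw [inv_pow]
  exact modDelta_sq_inv_le L e dV hdV dW hdW hp

/-- **REAL POWERS**: for every `T` there are `C, A ≥ 0` with `modDelta p ^ t ≤ C·‖p‖^A` for all `p ∈ P_Δ(𝔸)` and all `|t| ≤ T`.
[cite: MoeglinWaldspurger1995, I.2.2 (vi)–(vii)] [cite: BorelJacquet1979, §1.2] -/
theorem exists_modDelta_rpow_le_height [NeZero n] (T : ℝ) (hT : 0 ≤ T) :
    ∃ C A : ℝ, 0 ≤ C ∧ 0 ≤ A ∧ ∀ p : HA L e dV hdV dW hdW, IsSiegelDelta L e dV hdV dW hdW p → ∀ t : ℝ, |t| ≤ T →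
      modDelta L e dV hdV dW hdW p ^ t ≤ C * adelicHeightGL (n + n) L (p : GL (Fin (n + n)) (AdeleRing (𝓞 L) L)) ^ A := by
  haveI : NeZero (n + n) := ⟨fun h => NeZero.ne n (by omega)⟩
  obtain ⟨C, A, hC, hA, hle⟩ := exists_modDelta_le_height L e dV hdV dW hdW
  obtain ⟨C₁, hC₁, hfl⟩ := exists_one_sup_two_mul_le (K := L) (N := n + n)
  -- `modDelta^{±1} ≤ C x^A ≤ B := (1 ⊔ C)(C₁ x)^A` with `1 ≤ B`, so `modDelta^t ≤ B^{|t|} ≤ B^T = ((1 ⊔ C) C₁^A)^T · x^{A T}`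
  refine ⟨((1 ⊔ C) * C₁ ^ A) ^ T, A * T, by positivity, by positivity, fun p hp t ht => ?_⟩
  set x : ℝ := adelicHeightGL (n + n) L (p : GL (Fin (n + n)) (AdeleRing (𝓞 L) L)) with hx
  have hxpos : 0 < x := adelicHeightGL_pos_holds _
  have hx0 : 0 ≤ x := hxpos.le
  have hmpos : 0 < modDelta L e dV hdV dW hdW p := modDelta_pos L e dV hdV dW hdW p
  obtain ⟨h₁, h₂⟩ := hle p hp
  have hx1 : 1 ≤ C₁ * x := le_sup_left.trans (hfl _)
  have hC₁1 : 1 ≤ C₁ := by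
    have h2x : 2 * x ≤ C₁ * x := le_sup_right.trans (hfl _)
    nlinarith
  set B : ℝ := (1 ⊔ C) * (C₁ * x) ^ A with hB
  have hxA : x ^ A ≤ (C₁ * x) ^ A := Real.rpow_le_rpow hx0 (le_mul_of_one_le_left hx0 hC₁1) hA
  have hCx : C * x ^ A ≤ B := mul_le_mul le_sup_right hxA (Real.rpow_nonneg hx0 _) (by positivity)
  have hB1 : 1 ≤ B := one_le_mul_of_one_le_of_one_le le_sup_left (Real.one_le_rpow hx1 hA)
  have hm : modDelta L e dV hdV dW hdW p ≤ B := h₁.trans hCx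
  have hmi : (modDelta L e dV hdV dW hdW p)⁻¹ ≤ B := h₂.trans hCx
  -- `modDelta^t ≤ B^{|t|} ≤ B^T`
  have habs : modDelta L e dV hdV dW hdW p ^ t ≤ B ^ |t| := by
    rcases le_or_gt 0 t with ht0 | ht0
    · rw [abs_of_nonneg ht0]
      exact Real.rpow_le_rpow hmpos.le hm ht0
    · rw [abs_of_neg ht0, ← inv_inv (modDelta L e dV hdV dW hdW p), Real.inv_rpow (inv_pos.2 hmpos).le,
        ← Real.rpow_neg (inv_pos.2 hmpos).le]
      exact Real.rpow_le_rpow (inv_pos.2 hmpos).le hmi (by linarith)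
  calc modDelta L e dV hdV dW hdW p ^ t ≤ B ^ |t| := habs
    _ ≤ B ^ T := Real.rpow_le_rpow_of_exponent_le hB1 ht
    _ = ((1 ⊔ C) * C₁ ^ A) ^ T * x ^ (A * T) := by
        rw [hB, Real.mul_rpow hC₁.le hx0, ← mul_assoc, Real.mul_rpow (by positivity) (Real.rpow_nonneg hx0 _),
          ← Real.rpow_mul hx0]

/-- **THE CHARACTER BOUND `hω` OF ★ `K2LiuBigCellGrowthOfEquivariance.growth_of_equivariance`.**  For `ω s p := u s p · (modDelta p : ℂ)^(κ − 2 s)` with a unitary part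
`‖u s p‖ ≤ 1` BY VALUE (e.g. `u s p = χ′(det_Δ p)`; the inducing character of `I(−s, χ′)` has `κ = n`): near every `z` with `0 < re z`,
`‖ω s p‖ ≤ C·‖p‖^A` for all `p ∈ P_Δ(𝔸)`. [cite: MoeglinWaldspurger1995, I.2.2, I.2.17] [cite: BorelJacquet1979, §1.2] -/
theorem exists_character_bound [NeZero n] (κ : ℝ) (u : ℂ → HA L e dV hdV dW hdW → ℂ) (hu : ∀ s p, ‖u s p‖ ≤ 1) :
    ∀ z : ℂ, 0 < z.re → ∃ C A ρ : ℝ, 0 ≤ C ∧ 0 ≤ A ∧ 0 < ρ ∧ ∀ s : ℂ, dist s z < ρ →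
      ∀ p ∈ {p : HA L e dV hdV dW hdW | IsSiegelDelta L e dV hdV dW hdW p},
        ‖u s p * ((modDelta L e dV hdV dW hdW p : ℝ) : ℂ) ^ ((κ : ℂ) - 2 * s)‖ ≤
          C * adelicHeightGL (n + n) L (p : GL (Fin (n + n)) (AdeleRing (𝓞 L) L)) ^ A := by
  intro z hz
  -- on `dist s z < 1`: `|κ − 2 re s| ≤ |κ| + 2 |re z| + 2 =: T`
  obtain ⟨C, A, hC, hA, hle⟩ := exists_modDelta_rpow_le_height L e dV hdV dW hdW (|κ| + 2 * |z.re| + 2) (by positivity)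
  refine ⟨C, A, 1, hC, hA, one_pos, fun s hs p hp => ?_⟩
  have hmpos : 0 < modDelta L e dV hdV dW hdW p := modDelta_pos L e dV hdV dW hdW p
  have hre : ((κ : ℂ) - 2 * s).re = κ - 2 * s.re := by simp
  have hsz : |s.re - z.re| ≤ 1 := by
    have h1 : |s.re - z.re| ≤ dist s z := by
      rw [Complex.dist_eq]; simpa using Complex.abs_re_le_norm (s - z)
    exact h1.trans hs.le
  have ht : |κ - 2 * s.re| ≤ |κ| + 2 * |z.re| + 2 := by
    obtain ⟨hl, hr⟩ := abs_le.1 hsz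
    have hκ₁ := le_abs_self κ
    have hκ₂ := neg_abs_le κ
    have hz₁ := le_abs_self z.re
    have hz₂ := neg_abs_le z.re
    exact abs_le.2 ⟨by linarith, by linarith⟩
  calc ‖u s p * ((modDelta L e dV hdV dW hdW p : ℝ) : ℂ) ^ ((κ : ℂ) - 2 * s)‖
      = ‖u s p‖ * modDelta L e dV hdV dW hdW p ^ (κ - 2 * s.re) := by
        rw [norm_mul, Complex.norm_cpow_eq_rpow_re_of_pos hmpos, hre]
    _ ≤ 1 * (C * adelicHeightGL (n + n) L (p : GL (Fin (n + n)) (AdeleRing (𝓞 L) L)) ^ A) :=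
        mul_le_mul (hu s p) (hle p hp _ ht) (Real.rpow_nonneg hmpos.le _) zero_le_one
    _ = C * adelicHeightGL (n + n) L (p : GL (Fin (n + n)) (AdeleRing (𝓞 L) L)) ^ A := one_mul _

end Frame

end Summit.HodgeConjecture.HodgeConjecture.Cruxes.HLiu418.K2LiuModDeltaHeightComparison

end
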